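import Summits.QuantumFields.QCD.Theorems.SmallFieldUltracontractivity.Negative.Tightness
import Literature.Probability.LatticeModels.TorusFourierProofs

/-!
# Stub `stub_diagonalMonotone` of line `point-centred-axial-parabolic`
(crux `Summit.QuantumFields.QCD.Theses.HeatSlicedQuarks.SmallFieldUltracontractivity`, item stmt-QuantumFields-8871)

Monotonicity of the on-diagonal heat kernel of a positive matrix `H = AᴴA`: the real function
`t ↦ Re exp(-t·AᴴA)(i,i)` is non-increasing on `[0, ∞)`.  General linear algebra (spectral theorem):
`exp(-t·AᴴA)(i,i) = Σ_k ‖U i k‖² e^{-t λ_k}` with `U` the unitary eigenvector matrix and `λ_k ≥ 0` the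
eigenvalues of `AᴴA`; every summand is non-increasing in `t`. [folklore]
-/

noncomputable section

namespace Summit.QuantumFields.QCD.Cruxes.SmallFieldUltracontractivity.PointCentredAxialParabolic

open Literature.MathematicalPhysics.QuantumLattice Literature.MathematicalPhysics.QuantumFieldTheory
open Literature.Probability.LatticeModels (TorusSite torusChar)
open Summit.QuantumFields.QCD.Theorems.SmallFieldUltracontractivity.Negative
open scoped Matrix ComplexConjugate ComplexOrder

section Spectral

variable {ι : Type*} [Fintype ι] [DecidableEq ι]

/-- **Spectral representation of the diagonal of the heat kernel.** For a complex square matrix `A`,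
real `t` and an index `i`, `Re exp(-t·AᴴA)(i,i) = Σ_k ‖U i k‖² · e^{-t λ_k}`, where `U` is the unitary
eigenvector matrix and `λ` the (real) eigenvalue family of the Hermitian matrix `AᴴA`
(`AᴴA = U diag(λ) U*`, `exp(-t·AᴴA) = U diag(e^{-tλ}) U*`). -/
theorem re_exp_neg_smul_apply_self_eq_sum (A : Matrix ι ι ℂ) (hH : (Aᴴ * A).IsHermitian)
    (t : ℝ) (i : ι) :
    ((NormedSpace.exp (-(t : ℂ) • (Aᴴ * A))) i i).re =
      ∑ k, ‖(hH.eigenvectorUnitary : Matrix ι ι ℂ) i k‖ ^ 2 *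
        Real.exp (-(t * hH.eigenvalues k)) := by
  -- adapted from `norm_exp_neg_smul_conjTranspose_mul_self_apply_le_one` (Negative/LoadBearing)
  set U : Matrix ι ι ℂ := (hH.eigenvectorUnitary : Matrix ι ι ℂ) with hUdef
  have hUu : star U * U = 1 := Unitary.coe_star_mul_self hH.eigenvectorUnitary
  set w : ι → ℂ := fun k => Complex.exp (-(t : ℂ) * ((hH.eigenvalues k : ℝ) : ℂ)) with hw
  have hspec : -(t : ℂ) • (Aᴴ * A) =
      U * Matrix.diagonal (fun k => -(t : ℂ) * ((hH.eigenvalues k : ℝ) : ℂ)) * star U := by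
    have h0 : Aᴴ * A = U * Matrix.diagonal (fun k => ((hH.eigenvalues k : ℝ) : ℂ)) * star U := by
      conv_lhs => rw [hH.spectral_theorem, Unitary.conjStarAlgAut_apply]
      rfl
    conv_lhs => rw [h0]
    rw [← Matrix.smul_mul, ← Matrix.mul_smul, ← Matrix.diagonal_smul]
    rfl
  have hinv : U⁻¹ = star U := Matrix.inv_eq_left_inv hUu
  have hunit : IsUnit U := by
    rw [Matrix.isUnit_iff_isUnit_det]
    exact Matrix.isUnit_det_of_left_inverse hUu
  have hwexp : NormedSpace.exp (fun k => -(t : ℂ) * ((hH.eigenvalues k : ℝ) : ℂ)) = w := by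
    funext k
    rw [Pi.coe_exp, hw, Complex.exp_eq_exp_ℂ]
  have hexp : NormedSpace.exp (-(t : ℂ) • (Aᴴ * A)) = U * Matrix.diagonal w * star U := by
    rw [hspec, ← hinv, Matrix.exp_conj _ _ hunit, Matrix.exp_diagonal, hwexp]
  have hentry : (U * Matrix.diagonal w * star U) i i = ∑ k, U i k * w k * star (U i k) := by
    rw [Matrix.mul_apply]
    refine Finset.sum_congr rfl fun k _ => ?_
    rw [Matrix.mul_diagonal, Matrix.star_apply]
  have hwk : ∀ k, w k = ((Real.exp (-(t * hH.eigenvalues k)) : ℝ) : ℂ) := by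
    intro k
    rw [Complex.ofReal_exp]
    push_cast
    rw [← neg_mul]
  have hk : ∀ k, U i k * w k * star (U i k) =
      (((‖U i k‖ ^ 2 * Real.exp (-(t * hH.eigenvalues k)) : ℝ)) : ℂ) := by
    intro k
    rw [mul_right_comm, Complex.star_def, Complex.mul_conj, Complex.normSq_eq_norm_sq, hwk k]
    push_cast
    rfl
  rw [hexp, hentry, Finset.sum_congr rfl fun k _ => hk k, ← Complex.ofReal_sum, Complex.ofReal_re]

end Spectral

/-- **Diagonal monotonicity of the heat kernel.** For every complex square matrix `A`, index `i`
and `0 ≤ t' ≤ t`, `Re exp(-t·AᴴA)(i,i) ≤ Re exp(-t'·AᴴA)(i,i)`: by the spectral representation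
`Re exp(-t·AᴴA)(i,i) = Σ_k ‖U i k‖² e^{-t λ_k}` with `λ_k ≥ 0` (`AᴴA` is positive semidefinite),
each summand is non-increasing in `t`. -/
theorem stub_diagonalMonotone :
    ∀ (ι : Type) [Fintype ι] [DecidableEq ι] (A : Matrix ι ι ℂ) (i : ι) (t' t : ℝ), 0 ≤ t' → t' ≤ t →
      ((NormedSpace.exp (-(t : ℂ) • (Aᴴ * A))) i i).re ≤ ((NormedSpace.exp (-(t' : ℂ) • (Aᴴ * A))) i i).re := by
  intro ι _ _ A i t' t _ ht't
  have hP : (Aᴴ * A).PosSemidef := Matrix.posSemidef_conjTranspose_mul_self A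
  have hH : (Aᴴ * A).IsHermitian := hP.isHermitian
  rw [re_exp_neg_smul_apply_self_eq_sum A hH t i, re_exp_neg_smul_apply_self_eq_sum A hH t' i]
  refine Finset.sum_le_sum fun k _ => ?_
  refine mul_le_mul_of_nonneg_left ?_ (sq_nonneg _)
  have hk : 0 ≤ hH.eigenvalues k := hP.eigenvalues_nonneg k
  exact Real.exp_le_exp.mpr (neg_le_neg (mul_le_mul_of_nonneg_right ht't hk))

end Summit.QuantumFields.QCD.Cruxes.SmallFieldUltracontractivity.PointCentredAxialParabolic

end
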